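import Literature.MathematicalPhysics.QuantumFieldTheory.BalabanImbrieJaffe1984to88.BIJ88DeltaLocULocalityTorus
import Literature.MathematicalPhysics.QuantumFieldTheory.BalabanImbrieJaffe1984to88.BIJ88DeltaLocSmallPlaquetteTorusCwt

/-!
# `BalabanImbrieJaffe1984to88.BIJ88DeltaLocULocalityTorusCwt` — T. Bałaban, J. Imbrie, A. Jaffe, *Effective action and cluster properties of
the abelian Higgs model*, Commun. Math. Phys. **114** (1988) 257–315 [BalabanImbrieJaffe1988], §2 pp. 263–264 [PDF 7–8]:
**THE `u`-LOCALITY CLAUSES OF (2.43)/(2.46) AND p. 264 l.2, LOCATED IN THE TORUS METRIC, FOR THE PRINTED (2.27)/(2.29) TORUS DATA** — gen 23's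
`BIJ88DeltaLocULocalityTorus` (locality of the concrete `Δ_{k,loc}(u)`, `P(u_k)` and of the walk operators in the BOND variables, with the explicit
dependence sets `depSet`/`uNbhd`) made METRIC for the data of record (p29's torus cubes `cubeFam`, weights `lamFam`, p13's cut-off `cutoff R₁ R₀`):
the cubes `□_α` have sup-torus diameter `< 2W + 2L^k` (`diam_cubeFam_le`), and on the rows of a deep `k`-site every active pair has its row IN its cube
(gen 22's `rows_of_deep` (ii″)), so the dependence set of a row `y` lies within torus distance `2W + 2L^k` of the `(k+1)`-block over `y`
(`depSet_near_torus_cwt`).  Consequently *"C^{(k)}_{Λ,loc}(u; x₁, x₂) depends only on u in an O(r(e_k)) neighborhood of x₁, x₂"* and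
*"C^{(k)}_{Λ,X}(u) depends only on u in X"* hold for the model's `C^{(k)}_Λ(u)` in the form: `u = u′` on every bond whose two endpoints lie within
torus distance `2W + 2L^k` of the `(k+1)`-blocks over the rows of `Λ` charted into the relevant site set ⟹ equal local parts / `X`-parts
(`cLoc_congr_near_torus_cwt`, `cX_congr_near_torus_cwt`), and the same for the entries of `Δ_{k,loc}(u) + κP(u_k)` (`op240_apply_congr_near_torus_cwt`).  Theorems only.

statement-level skeleton of published theorems with citation tags; proofs where landed; nothing here is a claim about the Yang–Mills mass gap

HONEST SCOPE.  `2W + 2L^k` is the located `O(r(e_k))` (print: `W ≈ r(e_k)`-scale half-width of the (2.27) cubes); the rows must be deep `k`-sites of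
the reference box (gen 22's depth `R₀ + R`, `R > 10L^k`, torus gap, `W ≥ 2s_g/3 + R₀/2 + R`) — exactly the binder list of gen 22/23's torus-data
members; `Ω₀` shorter than the torus (`L^kM₀_i < |T|`).  Termwise statements, any `a, c, κ`, cube size `M ≥ 1`, radius `ρ`, no smallness of `u`.
Imports: gen 23 `BIJ88DeltaLocULocalityTorus`, gen 22 `BIJ88DeltaLocSmallPlaquetteTorusCwt`.  Literature + Mathlib only.  Unit `lit-balaban-p31`
(literature-prover-lit-balaban-p31-g23-0), 2026-08-23.  NOT summit progress.
-/

open scoped BigOperators Matrix ComplexConjugate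
open Finset Matrix

namespace Literature.MathematicalPhysics.QuantumFieldTheory.BalabanImbrieJaffe1984to88.BIJ88DeltaLocULocalityTorusCwt

open Literature.MathematicalPhysics.QuantumFieldTheory.Balaban1983to89
open BIJ88Sect3Statements (U1 toC starB mem_starB)
open BIJ85BlockAveragesTorus BIJ85BlockAveragesTorusK
open BIJ88NeumannPropagatorFlatDecayCube (cubeT mem_cubeT_iff_val)
open BIJ88NeumannPropagatorFlatClose231 (fit_of_nested)
open BIJ88Cutoffs21 (cutoff)
open BIJ88LocWeights227Torus (cubeFam lamFam tLo tHi tLo_add_le)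
open BIJ88Close231RegularTorusCwt (deepRows mem_deepRows)
open BIJ88DeltaLoc234Torus (deltaLocT)
open BIJ88Eq240FlatTorus (op240)
open BIJ88DeltaLocSmallPlaquetteTorusCwt (rows_of_deep)
open BIJ88RandomWalk242 BIJ88Eq242Lattice BIJ88Ineq246Lattice B4Sect5CubeBounds
open BIJ88Locality246Lattice (nbhd sitesOf)
open BIJ88Eq242HiggsCovarianceTorus (chart chartSet idxEquiv reOp cdist cdist_le_of_forall T_le_cdist)
open BIJ88DeltaLocULocalityTorus

noncomputable section

variable {P : Params} {d : ℕ}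

/-! ## §1 The torus cubes of (2.27) have sup-torus diameter `< 2W + 2n` -/

section Diameter

/-- the block width of a cube: `tHi_i − tLo_i ≤ 2W/n + 2` (the chart box `|z_i − sα_i| ≤ W` rounded outward to `n`-blocks).
[cite: BalabanImbrieJaffe1988, (2.27) p.263] -/
theorem tHi_sub_tLo_le {n : ℕ} (hn : 0 < n) (M0 : Fin (d + 1) → ℕ) (s W : ℕ) (α : Fin (d + 1) → ℤ) (i : Fin (d + 1)) :
    tHi n M0 s W α i - tLo n M0 s W α i ≤ 2 * W / n + 2 := by
  have hto : ((s : ℤ) * α i + W).toNat ≤ ((s : ℤ) * α i - W).toNat + 2 * W := by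
    rw [Int.toNat_le]
    have := Int.self_le_toNat ((s : ℤ) * α i - W)
    push_cast
    omega
  have hdiv : ((s : ℤ) * α i + W).toNat / n ≤ ((s : ℤ) * α i - W).toNat / n + 2 * W / n + 1 := by
    refine (Nat.div_le_div_right hto).trans ?_
    rw [Nat.add_div hn]
    split_ifs <;> omega
  show min (M0 i) (((s : ℤ) * α i + W).toNat / n + 1) - min (M0 i - 1) (((s : ℤ) * α i - W).toNat / n) ≤ 2 * W / n + 2
  generalize ((s : ℤ) * α i + W).toNat / n = q2 at hdiv ⊢
  generalize ((s : ℤ) * α i - W).toNat / n = q1 at hdiv ⊢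
  generalize 2 * W / n = g at hdiv ⊢
  rcases Nat.le_total (M0 i - 1) q1 with h | h
  · rw [min_eq_left h]
    have : min (M0 i) (q2 + 1) ≤ M0 i := min_le_left _ _
    omega
  · rw [min_eq_right h]
    have : min (M0 i) (q2 + 1) ≤ q2 + 1 := min_le_right _ _
    omega

/-- **the cubes `□_α` of the printed torus data have sup-torus diameter `< 2W + 2n`**: for `z, z′ ∈ cubeFam … α`, `|z − z′|_T ≤ 2W + 2n`
(the chart coordinates of both lie in `n`-block ranges of width `n(tHi_i − tLo_i) ≤ 2W + 2n`). [cite: BalabanImbrieJaffe1988, (2.27) p.263] -/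
theorem diam_cubeFam_le (hPd : P.d = d + 1) {n : ℕ} (hn : 0 < n) {c M0 : Fin (d + 1) → ℕ} (hfit0 : ∀ i, c i * n + n * M0 i ≤ P.sitesPerDir 0)
    (s W : ℕ) (α : ↥(BIJ88LocWeights227Torus.labels n M0 s)) {z z' : Balaban1983to89.Site P 0} (hz : z ∈ cubeFam hPd n c M0 s W α)
    (hz' : z' ∈ cubeFam hPd n c M0 s W α) : B5Ineq137Torus.T P 0 z z' ≤ 2 * (W : ℝ) + 2 * n := by
  have hfit : ∀ i, (c + tLo n M0 s W α.1) i * n + n * (tHi n M0 s W α.1 i - tLo n M0 s W α.1 i) ≤ P.sitesPerDir 0 :=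
    fit_of_nested (tLo_add_le α.1) hfit0
  have hzv := (mem_cubeT_iff_val hPd hfit z).1 hz
  have hz'v := (mem_cubeT_iff_val hPd hfit z').1 hz'
  refine (T_le_cdist z z').trans (cdist_le_of_forall (by positivity) fun μ => ?_)
  obtain ⟨a1, b1⟩ := hzv μ
  obtain ⟨a2, b2⟩ := hz'v μ
  have hw : n * (tHi n M0 s W α.1 (Fin.cast hPd μ) - tLo n M0 s W α.1 (Fin.cast hPd μ)) ≤ 2 * W + 2 * n := by
    have h1 := Nat.mul_le_mul_left n (tHi_sub_tLo_le hn M0 s W α.1 (Fin.cast hPd μ))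
    have h2 : n * (2 * W / n) ≤ 2 * W := Nat.mul_div_le _ _
    rw [Nat.mul_add] at h1
    omega
  rw [abs_le]
  constructor
  · have : ((z' μ).val : ℝ) ≤ ((z μ).val : ℝ) + (2 * W + 2 * n : ℕ) := by exact_mod_cast (by omega)
    push_cast at this; linarith
  · have : ((z μ).val : ℝ) ≤ ((z' μ).val : ℝ) + (2 * W + 2 * n : ℕ) := by exact_mod_cast (by omega)
    push_cast at this; linarith

end Diameter

/-! ## §2 The dependence set of a deep row lies within `2W + 2L^k` of its `(k+1)`-block -/

section DepSet

/-- **the dependence set of a deep `k`-site is an `O(r(e_k))`-neighbourhood, located**: for the printed torus data and a `k`-site `y` whose block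
lies in `Ω₀` with chart margin `R₀ + R` (gen 22's `rows_of_deep` hypotheses), every site of `depSet k cubeFam lamFam ζ″ y` lies within sup-torus
distance `2W + 2L^k` of `B^{k+1}` over `y` — gen 23's `depSet_subset_near` with row hypothesis (ii″) and §1.
[cite: BalabanImbrieJaffe1988, (2.27) p.263, p.264 ("O(r(e_k))-neighborhood of x₁, x₂")] -/
theorem depSet_near_torus_cwt (hPd : P.d = d + 1) {k sg W : ℕ} {c M0 : Fin (d + 1) → ℕ} (hk : 0 + k ≤ P.m + P.K)
    (hsg : 0 < sg) (hfit0 : ∀ i, c i * P.L ^ k + P.L ^ k * M0 i ≤ P.sitesPerDir 0) {R R₀ R₁ : ℝ} (hR₁ : 0 ≤ R₁)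
    (hR10 : R₁ < R₀) (hRm : 10 * (P.L : ℝ) ^ k < R) (hgap : ∀ i, ((P.L ^ k * M0 i : ℕ) : ℝ) + R ≤ P.sitesPerDir 0)
    (hW : 2 * (sg : ℝ) / 3 + R₀ / 2 + R ≤ W) {y : Balaban1983to89.Site P (0 + k)}
    (hdeepB : ∀ μ, (c (Fin.cast hPd μ) : ℝ) * P.L ^ k + (R₀ + R) ≤ (P.L : ℝ) ^ k * (y μ).val ∧
      (P.L : ℝ) ^ k * (y μ).val + P.L ^ k + (R₀ + R) ≤ (c (Fin.cast hPd μ) : ℝ) * P.L ^ k + (P.L : ℝ) ^ k * M0 (Fin.cast hPd μ)) :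
    ∀ z ∈ depSet k (cubeFam hPd (P.L ^ k) c M0 sg W) (lamFam hPd (P.L ^ k) c M0 sg) (cutoff R₁ R₀ (B5Ineq137Torus.T P 0)) y,
      ∃ x ∈ blockK (k+1) (blockOf y), B5Ineq137Torus.T P 0 x z ≤ 2 * (W : ℝ) + 2 * (P.L ^ k : ℕ) := by
  have hn : 1 ≤ P.L ^ k := Nat.one_le_pow _ _ P.L_pos
  have hPk : (0 : ℝ) < (P.L : ℝ) ^ k := pow_pos P.cast_L_pos k
  have hR : 0 ≤ R := le_trans (by positivity) hRm.le
  obtain ⟨-, -, hii, -, -⟩ := rows_of_deep hPd hk hn hsg hfit0 hR hR₁ hR10 hRm hgap hW hdeepB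
  refine depSet_subset_near (by positivity) (fun x₁ hx₁ α x₂ hne => ?_) (fun α z hz z' hz' => ?_)
  · have hx := (hii x₁ hx₁ α x₂ hne).1
    have h0 : B5Ineq137Torus.T P 0 x₁ x₁ ≤ 10 * (P.L : ℝ) ^ k := by rw [B5Ineq137Torus.T_self]; positivity
    exact (mem_deepRows.1 hx) x₁ h0
  · have h := diam_cubeFam_le hPd (by omega) hfit0 sg W α hz hz'
    exact_mod_cast h

end DepSet

/-! ## §3 The located clauses for the model's `C^{(k)}_Λ(u)` and for `Δ_{k,loc}(u) + κP(u_k)` with the printed torus data -/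

section Clauses

variable (hPd : P.d = d + 1) {k sg W : ℕ} {c M0 : Fin (d + 1) → ℕ}

/-- **bond agreement on the `u`-neighbourhood from metric agreement**: if `u = u′` on every bond whose endpoints are both near the rows of `Λ` charted into `S`,
then `BondAgree (uNbhd k Λ cubeFam lamFam ζ″ S) u u′` (for `Λ` of deep `k`-sites; «near» = within sup-torus distance `2W + 2L^k` of the
`(k+1)`-block over some `y ∈ Λ` with `chart y ∈ S`). [cite: BalabanImbrieJaffe1988, p.264] -/
theorem bondAgree_uNbhd_of_near (hk : 0 + k ≤ P.m + P.K) (hsg : 0 < sg) (hfit0 : ∀ i, c i * P.L ^ k + P.L ^ k * M0 i ≤ P.sitesPerDir 0)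
    {R R₀ R₁ : ℝ} (hR₁ : 0 ≤ R₁) (hR10 : R₁ < R₀) (hRm : 10 * (P.L : ℝ) ^ k < R) (hgap : ∀ i, ((P.L ^ k * M0 i : ℕ) : ℝ) + R ≤ P.sitesPerDir 0)
    (hW : 2 * (sg : ℝ) / 3 + R₀ / 2 + R ≤ W) {Λ : Finset (Balaban1983to89.Site P (0 + k))}
    (hΛ : ∀ y₁ ∈ Λ, ∀ μ, (c (Fin.cast hPd μ) : ℝ) * P.L ^ k + (R₀ + R) ≤ (P.L : ℝ) ^ k * (y₁ μ).val ∧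
      (P.L : ℝ) ^ k * (y₁ μ).val + P.L ^ k + (R₀ + R) ≤ (c (Fin.cast hPd μ) : ℝ) * P.L ^ k + (P.L : ℝ) ^ k * M0 (Fin.cast hPd μ))
    {S : Finset (Fin P.d → ℤ)} {U U' : GaugeField P 0 U1}
    (h : ∀ b : PBond P 0, (∃ y ∈ Λ, chart y ∈ S ∧ ∃ x ∈ blockK (k+1) (blockOf y), B5Ineq137Torus.T P 0 x b.src ≤ 2 * (W : ℝ) + 2 * (P.L ^ k : ℕ)) → (∃ y ∈ Λ, chart y ∈ S ∧ ∃ x ∈ blockK (k+1) (blockOf y), B5Ineq137Torus.T P 0 x b.tgt ≤ 2 * (W : ℝ) + 2 * (P.L ^ k : ℕ)) →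
      U b = U' b) :
    BondAgree (uNbhd k Λ (cubeFam hPd (P.L ^ k) c M0 sg W) (lamFam hPd (P.L ^ k) c M0 sg) (cutoff R₁ R₀ (B5Ineq137Torus.T P 0)) S) U U' := by
  classical
  have near : ∀ z ∈ uNbhd k Λ (cubeFam hPd (P.L ^ k) c M0 sg W) (lamFam hPd (P.L ^ k) c M0 sg) (cutoff R₁ R₀ (B5Ineq137Torus.T P 0)) S,
      (∃ y ∈ Λ, chart y ∈ S ∧ ∃ x ∈ blockK (k+1) (blockOf y), B5Ineq137Torus.T P 0 x z ≤ 2 * (W : ℝ) + 2 * (P.L ^ k : ℕ)) := by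
    intro z hz
    obtain ⟨y, hy, hzy⟩ := Finset.mem_biUnion.1 hz
    obtain ⟨hyΛ, hyS⟩ := Finset.mem_filter.1 hy
    obtain ⟨x, hx, hxz⟩ := depSet_near_torus_cwt hPd hk hsg hfit0 hR₁ hR10 hRm hgap hW (hΛ y hyΛ) z hzy
    exact ⟨y, hyΛ, hyS, x, hx, hxz⟩
  intro b hb
  rw [mem_starB] at hb
  exact h b (near _ hb.1) (near _ hb.2)

/-- **(2.43), LOCATED `u`-LOCALITY CLAUSE FOR THE MODEL's `C^{(k)}_Λ(u)` WITH THE PRINTED TORUS DATA** — *"The local part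
C^{(k)}_{Λ,loc}(u; x₁, x₂) depends only on u in an O(r(e_k)) neighborhood of x₁, x₂"*: for `Λ` of deep `k`-sites of the reference box (gen 22's
data), any `a, c, κ`, cubes `M ≥ 1`, radius `ρ`: if `u = u′` on every fine bond whose endpoints both lie within sup-torus distance `2W + 2L^k` of the
`(k+1)`-block over some `y ∈ Λ` charted within `(ρ + 1)M` of `x₁` and of `x₂`, then the local parts at `(x₁, x₂)` coincide — gen 23's
`cLoc_congr_bonds` + §2. [cite: BalabanImbrieJaffe1988, (2.43) p.264] -/
theorem cLoc_congr_near_torus_cwt (hk1 : 0 + k + 1 ≤ P.m + P.K) (hsg : 0 < sg) (hfit0 : ∀ i, c i * P.L ^ k + P.L ^ k * M0 i ≤ P.sitesPerDir 0)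
    {R R₀ R₁ : ℝ} (hR₁ : 0 ≤ R₁) (hR10 : R₁ < R₀) (hRm : 10 * (P.L : ℝ) ^ k < R) (hgap : ∀ i, ((P.L ^ k * M0 i : ℕ) : ℝ) + R ≤ P.sitesPerDir 0)
    (hW : 2 * (sg : ℝ) / 3 + R₀ / 2 + R ≤ W) {Λ : Finset (Balaban1983to89.Site P (0 + k))}
    (hΛ : ∀ y₁ ∈ Λ, ∀ μ, (c (Fin.cast hPd μ) : ℝ) * P.L ^ k + (R₀ + R) ≤ (P.L : ℝ) ^ k * (y₁ μ).val ∧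
      (P.L : ℝ) ^ k * (y₁ μ).val + P.L ^ k + (R₀ + R) ≤ (c (Fin.cast hPd μ) : ℝ) * P.L ^ k + (P.L : ℝ) ^ k * M0 (Fin.cast hPd μ))
    {a cc : ℝ} (κ : ℝ) {M : ℕ} (hM : 0 < M) (ρ : ℝ) (p q : B4.Idx (chartSet Λ) 2) {U U' : GaugeField P 0 U1}
    (h : ∀ b : PBond P 0, (∃ y ∈ Λ, chart y ∈ nbhd M ρ p ∩ nbhd M ρ q ∧ ∃ x ∈ blockK (k+1) (blockOf y), B5Ineq137Torus.T P 0 x b.src ≤ 2 * (W : ℝ) + 2 * (P.L ^ k : ℕ)) →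
      (∃ y ∈ Λ, chart y ∈ nbhd M ρ p ∩ nbhd M ρ q ∧ ∃ x ∈ blockK (k+1) (blockOf y), B5Ineq137Torus.T P 0 x b.tgt ≤ 2 * (W : ℝ) + 2 * (P.L ^ k : ℕ)) → U b = U' b) :
    cLoc (ldist (N := 2) M) ρ
        (fun ω y₁ y₂ => latticeCw M (chartSet Λ) 2 (reOp Λ (op240 (deltaLocT a cc U k (cubeFam hPd (P.L ^ k) c M0 sg W)
          (lamFam hPd (P.L ^ k) c M0 sg) (cutoff R₁ R₀ (B5Ineq137Torus.T P 0))) κ (lineIter U k))) ω y₁ y₂) p q =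
      cLoc (ldist (N := 2) M) ρ
        (fun ω y₁ y₂ => latticeCw M (chartSet Λ) 2 (reOp Λ (op240 (deltaLocT a cc U' k (cubeFam hPd (P.L ^ k) c M0 sg W)
          (lamFam hPd (P.L ^ k) c M0 sg) (cutoff R₁ R₀ (B5Ineq137Torus.T P 0))) κ (lineIter U' k))) ω y₁ y₂) p q :=
  cLoc_congr_bonds hk1 hM κ ρ p q (bondAgree_uNbhd_of_near hPd (by omega) hsg hfit0 hR₁ hR10 hRm hgap hW hΛ h)

/-- **(2.46), LOCATED `u`-LOCALITY CLAUSE FOR THE MODEL's `C^{(k)}_Λ(u)` WITH THE PRINTED TORUS DATA** — *"The operator C^{(k)}_{Λ,X}(u) depends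
only on u in X"*: if `u = u′` on every fine bond whose endpoints both lie within sup-torus distance `2W + 2L^k` of the `(k+1)`-block over some
`y ∈ Λ` charted into the sites of `X` (p13's `sitesOf X`), then `C^{(k)}_{Λ,X}(u) = C^{(k)}_{Λ,X}(u′)` entrywise — gen 23's `cX_congr_bonds` + §2.
[cite: BalabanImbrieJaffe1988, (2.46) p.264] -/
theorem cX_congr_near_torus_cwt (hk1 : 0 + k + 1 ≤ P.m + P.K) (hsg : 0 < sg) (hfit0 : ∀ i, c i * P.L ^ k + P.L ^ k * M0 i ≤ P.sitesPerDir 0)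
    {R R₀ R₁ : ℝ} (hR₁ : 0 ≤ R₁) (hR10 : R₁ < R₀) (hRm : 10 * (P.L : ℝ) ^ k < R) (hgap : ∀ i, ((P.L ^ k * M0 i : ℕ) : ℝ) + R ≤ P.sitesPerDir 0)
    (hW : 2 * (sg : ℝ) / 3 + R₀ / 2 + R ≤ W) {Λ : Finset (Balaban1983to89.Site P (0 + k))}
    (hΛ : ∀ y₁ ∈ Λ, ∀ μ, (c (Fin.cast hPd μ) : ℝ) * P.L ^ k + (R₀ + R) ≤ (P.L : ℝ) ^ k * (y₁ μ).val ∧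
      (P.L : ℝ) ^ k * (y₁ μ).val + P.L ^ k + (R₀ + R) ≤ (c (Fin.cast hPd μ) : ℝ) * P.L ^ k + (P.L : ℝ) ^ k * M0 (Fin.cast hPd μ))
    {a cc : ℝ} (κ : ℝ) {M : ℕ} (hM : 0 < M) (ρ : ℝ) {s : ℕ} (X : Finset (Cubes M s (chartSet Λ))) (p q : B4.Idx (chartSet Λ) 2)
    {U U' : GaugeField P 0 U1}
    (h : ∀ b : PBond P 0, (∃ y ∈ Λ, chart y ∈ sitesOf M s X ∧ ∃ x ∈ blockK (k+1) (blockOf y), B5Ineq137Torus.T P 0 x b.src ≤ 2 * (W : ℝ) + 2 * (P.L ^ k : ℕ)) →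
      (∃ y ∈ Λ, chart y ∈ sitesOf M s X ∧ ∃ x ∈ blockK (k+1) (blockOf y), B5Ineq137Torus.T P 0 x b.tgt ≤ 2 * (W : ℝ) + 2 * (P.L ^ k : ℕ)) → U b = U' b) :
    cX (ldist (N := 2) M) ρ (cubeOf M s) touch
        (fun ω y₁ y₂ => latticeCw M (chartSet Λ) 2 (reOp Λ (op240 (deltaLocT a cc U k (cubeFam hPd (P.L ^ k) c M0 sg W)
          (lamFam hPd (P.L ^ k) c M0 sg) (cutoff R₁ R₀ (B5Ineq137Torus.T P 0))) κ (lineIter U k))) ω y₁ y₂) X p q =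
      cX (ldist (N := 2) M) ρ (cubeOf M s) touch
        (fun ω y₁ y₂ => latticeCw M (chartSet Λ) 2 (reOp Λ (op240 (deltaLocT a cc U' k (cubeFam hPd (P.L ^ k) c M0 sg W)
          (lamFam hPd (P.L ^ k) c M0 sg) (cutoff R₁ R₀ (B5Ineq137Torus.T P 0))) κ (lineIter U' k))) ω y₁ y₂) X p q :=
  cX_congr_bonds hk1 hM κ ρ X p q (bondAgree_uNbhd_of_near hPd (by omega) hsg hfit0 hR₁ hR10 hRm hgap hW hΛ h)

/-- **p. 264 l.2, LOCATED, FOR THE PRINTED TORUS DATA** — *"Δ_{k,loc}(u; x₁, x₂) depends on u only in an O(r(e_k))-neighborhood of x₁, x₂"*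
(with the averaging term of (2.40)): for deep `k`-sites `y₁, y₂` of the reference box, if `u = u′` on every fine bond whose endpoints both lie
within sup-torus distance `2W + 2L^k` of `B^{k+1}` over `y₁` or over `y₂`, then the `(y₁, y₂)` entries of `Δ_{k,loc}(u) + κP(u_k)` and
`Δ_{k,loc}(u′) + κP(u′_k)` coincide — gen 23's `op240_apply_congr` + §2. [cite: BalabanImbrieJaffe1988, (2.34) p.263, p.264 (line 2)] -/
theorem op240_apply_congr_near_torus_cwt (hk1 : 0 + k + 1 ≤ P.m + P.K) (hsg : 0 < sg)
    (hfit0 : ∀ i, c i * P.L ^ k + P.L ^ k * M0 i ≤ P.sitesPerDir 0) {R R₀ R₁ : ℝ} (hR₁ : 0 ≤ R₁) (hR10 : R₁ < R₀)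
    (hRm : 10 * (P.L : ℝ) ^ k < R) (hgap : ∀ i, ((P.L ^ k * M0 i : ℕ) : ℝ) + R ≤ P.sitesPerDir 0) (hW : 2 * (sg : ℝ) / 3 + R₀ / 2 + R ≤ W)
    {y₁ y₂ : Balaban1983to89.Site P (0 + k)}
    (hy₁ : ∀ μ, (c (Fin.cast hPd μ) : ℝ) * P.L ^ k + (R₀ + R) ≤ (P.L : ℝ) ^ k * (y₁ μ).val ∧
      (P.L : ℝ) ^ k * (y₁ μ).val + P.L ^ k + (R₀ + R) ≤ (c (Fin.cast hPd μ) : ℝ) * P.L ^ k + (P.L : ℝ) ^ k * M0 (Fin.cast hPd μ))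
    (hy₂ : ∀ μ, (c (Fin.cast hPd μ) : ℝ) * P.L ^ k + (R₀ + R) ≤ (P.L : ℝ) ^ k * (y₂ μ).val ∧
      (P.L : ℝ) ^ k * (y₂ μ).val + P.L ^ k + (R₀ + R) ≤ (c (Fin.cast hPd μ) : ℝ) * P.L ^ k + (P.L : ℝ) ^ k * M0 (Fin.cast hPd μ))
    {a cc : ℝ} (κ : ℝ) {U U' : GaugeField P 0 U1}
    (h : ∀ b : PBond P 0,
      (∃ x ∈ blockK (k+1) (blockOf y₁) ∪ blockK (k+1) (blockOf y₂), B5Ineq137Torus.T P 0 x b.src ≤ 2 * (W : ℝ) + 2 * (P.L ^ k : ℕ)) →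
      (∃ x ∈ blockK (k+1) (blockOf y₁) ∪ blockK (k+1) (blockOf y₂), B5Ineq137Torus.T P 0 x b.tgt ≤ 2 * (W : ℝ) + 2 * (P.L ^ k : ℕ)) →
      U b = U' b) :
    op240 (deltaLocT a cc U k (cubeFam hPd (P.L ^ k) c M0 sg W) (lamFam hPd (P.L ^ k) c M0 sg) (cutoff R₁ R₀ (B5Ineq137Torus.T P 0))) κ
        (lineIter U k) y₁ y₂ =
      op240 (deltaLocT a cc U' k (cubeFam hPd (P.L ^ k) c M0 sg W) (lamFam hPd (P.L ^ k) c M0 sg) (cutoff R₁ R₀ (B5Ineq137Torus.T P 0))) κ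
        (lineIter U' k) y₁ y₂ := by
  have hk : 0 + k ≤ P.m + P.K := by omega
  refine op240_apply_congr hk1 κ fun b hb => ?_
  rw [mem_starB] at hb
  have near : ∀ z ∈ depSet k (cubeFam hPd (P.L ^ k) c M0 sg W) (lamFam hPd (P.L ^ k) c M0 sg) (cutoff R₁ R₀ (B5Ineq137Torus.T P 0)) y₁ ∪
      depSet k (cubeFam hPd (P.L ^ k) c M0 sg W) (lamFam hPd (P.L ^ k) c M0 sg) (cutoff R₁ R₀ (B5Ineq137Torus.T P 0)) y₂,
      ∃ x ∈ blockK (k+1) (blockOf y₁) ∪ blockK (k+1) (blockOf y₂), B5Ineq137Torus.T P 0 x z ≤ 2 * (W : ℝ) + 2 * (P.L ^ k : ℕ) := by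
    intro z hz
    rcases Finset.mem_union.1 hz with hz | hz
    · obtain ⟨x, hx, hxz⟩ := depSet_near_torus_cwt hPd hk hsg hfit0 hR₁ hR10 hRm hgap hW hy₁ z hz
      exact ⟨x, Finset.mem_union_left _ hx, hxz⟩
    · obtain ⟨x, hx, hxz⟩ := depSet_near_torus_cwt hPd hk hsg hfit0 hR₁ hR10 hRm hgap hW hy₂ z hz
      exact ⟨x, Finset.mem_union_right _ hx, hxz⟩
  exact h b (near _ hb.1) (near _ hb.2)

end Clauses

end

end Literature.MathematicalPhysics.QuantumFieldTheory.BalabanImbrieJaffe1984to88.BIJ88DeltaLocULocalityTorusCwt
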